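import Summits.BirchSwinnertonDyer.Rank1Residual.P2.PrintCf2SplitBadTwoLocalUntwist

set_option autoImplicit false

/-!
# Critic g47 certificate: R227's residual `LocalUntwistExists` is CLOSED BY NAME in the tree (port P52, p754294)

STUB-PLAN v8.1 (row 132, R227) left road B′ kernel-complete modulo {`PacketMatching`, `LocalUntwistExists`} ⊕ R220-CUT.
The second residual is the `Prop` vendored VERBATIM from k3-g40 §4 into k1-g43's sketch
(`Cruxes/SplitBadTwoLowerHalfOfFacts/STUB_IDEAS_stub_heegnerIndexLowerAtTwo_1_g43.lean` ll. 1161–1241, namespace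
`…Cruxes.SplitBadTwoLowerHalfOfFacts.ReadTwoCutK3G40`).  Typer ty2 g45's port P52
`Summits/BirchSwinnertonDyer/Rank1Residual/P2/PrintCf2SplitBadTwoLocalUntwist.lean` carries the SAME two definitions
(token-identical bodies) and PROVES the node: `Summit.BirchSwinnertonDyer.Rank1Residual.P2.LocalUntwist.localUntwistExists`.

This file restates the vendored text verbatim (namespace `CriticG47`, same binders) and closes it by the tree theorem, by
definitional unfolding only — so the vendored residual and the tree theorem have literally the same type up to names.
Nothing here proves BSD, the crux `PrintCf2.SplitBadTwoLowerHalfOfFacts` or the stub `stub_heegnerIndexLowerAtTwo`; no `sorry`.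
-/

noncomputable section

namespace Summit.BirchSwinnertonDyer.BirchSwinnertonDyer.Cruxes.SplitBadTwoLowerHalfOfFacts.CriticG47

open ValuativeRel IsLocalRing Field
open Literature.NumberTheory.GaloisRepresentations Literature.NumberTheory.GaloisRepresentations.IsNonarchimedeanLocalField
  Literature.NumberTheory.GaloisRepresentations.LubinTate Literature.NumberTheory.PAdicHodge

variable {F : Type} [Field F] [ValuativeRel F] [TopologicalSpace F] [IsNonarchimedeanLocalField F]

attribute [local instance] ltNormUniformSpace ltNormIsUniformAddGroup rk1 nF nE fintypeResidueField

variable {π : 𝒪[F]} (hπ : (valuation F).IsUniformizer (π : F))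
variable (E : IntermediateField F (AlgebraicClosure F)) [FiniteDimensional F E] [Normal F E]

/-- VERBATIM k3-g40 §4 / k1-g43 l. 1161: "`τ ∈ Aut_F(E·K_π^{m+1})` acts on `𝒪_E` as `φ^K`". -/
def ActsAsFrobPow (σ₀ : absoluteGaloisGroup F) (K : ℕ) {m : ℕ}
    (τ : (E ⊔ ltField π m : IntermediateField F (AlgebraicClosure F)) ≃ₐ[F]
      (E ⊔ ltField π m : IntermediateField F (AlgebraicClosure F))) : Prop :=
  ∀ x : unitBall E, τ (IntermediateField.inclusion le_sup_left (x : E)) =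
    IntermediateField.inclusion le_sup_left
      (((((frobUnitBall E σ₀ : unitBall E ≃+* unitBall E) : unitBall E →+* unitBall E) :
        unitBall E → unitBall E)^[K] x : unitBall E) : E)

/-- VERBATIM k3-g40 §4 / k1-g43 l. 1234: the typed sub-stub `LocalUntwistExists` (R217∃). -/
def LocalUntwistExists (hE : E ≤ maxUnramified F) (σ₀ : absoluteGaloisGroup F) : Prop :=
  ∀ (m K : ℕ) (v : 𝒪[F]ˣ), ∃ τ : (E ⊔ ltField π m : IntermediateField F (AlgebraicClosure F)) ≃ₐ[F]
      (E ⊔ ltField π m : IntermediateField F (AlgebraicClosure F)),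
    ActsAsFrobPow E σ₀ K τ ∧
      mapPt τ (inclPt (le_sup_right : ltField π m ≤ E ⊔ ltField π m) (cohPt hπ m)) =
        mapPt (relGalOfUnit hπ E m hE v) (inclPt (le_sup_right : ltField π m ≤ E ⊔ ltField π m) (cohPt hπ m))

/-- The vendored `ActsAsFrobPow` IS the tree's (P52), definitionally. -/
theorem actsAsFrobPow_iff_tree (σ₀ : absoluteGaloisGroup F) (K : ℕ) {m : ℕ}
    (τ : (E ⊔ ltField π m : IntermediateField F (AlgebraicClosure F)) ≃ₐ[F]
      (E ⊔ ltField π m : IntermediateField F (AlgebraicClosure F))) :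
    ActsAsFrobPow (π := π) E σ₀ K τ ↔
      Summit.BirchSwinnertonDyer.Rank1Residual.P2.LocalUntwist.ActsAsFrobPow (π := π) E σ₀ K τ :=
  Iff.rfl

/-- The vendored `LocalUntwistExists` IS the tree's (P52), definitionally. -/
theorem localUntwistExists_iff_tree (hE : E ≤ maxUnramified F) (σ₀ : absoluteGaloisGroup F) :
    LocalUntwistExists hπ E hE σ₀ ↔
      Summit.BirchSwinnertonDyer.Rank1Residual.P2.LocalUntwist.LocalUntwistExists hπ E hE σ₀ :=
  Iff.rfl

/-- ★ **R227's residual `LocalUntwistExists` holds** — by the tree theorem `P2.LocalUntwist.localUntwistExists` (p754294). -/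
theorem localUntwistExists (hE : E ≤ maxUnramified F) (σ₀ : absoluteGaloisGroup F) :
    LocalUntwistExists hπ E hE σ₀ :=
  Summit.BirchSwinnertonDyer.Rank1Residual.P2.LocalUntwist.localUntwistExists hπ E hE σ₀

/-- The offset instance k3-g40's `exists_untwisted_table` consumes (`K = m + 1 + k`), hypothesis-free. -/
theorem localUntwistExists_offset (hE : E ≤ maxUnramified F) (σ₀ : absoluteGaloisGroup F) (m k : ℕ) (v : 𝒪[F]ˣ) :
    ∃ τ : (E ⊔ ltField π m : IntermediateField F (AlgebraicClosure F)) ≃ₐ[F]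
        (E ⊔ ltField π m : IntermediateField F (AlgebraicClosure F)),
      ActsAsFrobPow E σ₀ (m + 1 + k) τ ∧
        mapPt τ (inclPt (le_sup_right : ltField π m ≤ E ⊔ ltField π m) (cohPt hπ m)) =
          mapPt (relGalOfUnit hπ E m hE v) (inclPt (le_sup_right : ltField π m ≤ E ⊔ ltField π m) (cohPt hπ m)) :=
  localUntwistExists hπ E hE σ₀ m (m + 1 + k) v

end Summit.BirchSwinnertonDyer.BirchSwinnertonDyer.Cruxes.SplitBadTwoLowerHalfOfFacts.CriticG47

end
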